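import Mathlib
import HarnessLib
import Summits.HubbardSuperconductivity.HubbardSuperconductivity.Theorems.KLProgrammeKLRegimeEngineTwoLegStepV17FDoorPkg
import Summits.HubbardSuperconductivity.HubbardSuperconductivity.Theorems.KLProgrammeKLRegimeVolumeLimitFlowFrames

/-!
# K3 gen 7-flow, ENGINE child stubs (e)/(M): the two-leg doors for an ARBITRARY comparison history (so every successor slot text —
# `TwoLegStepV17F` (p524744), `TwoLegStepV17F2` (S1 rev 2, p527694: cured engine slot in the history), … — instantiates them by `exact`)

Cell gate-hubbard-kl, seat hubbard-kl-r2d-p1 (g5).  Sequel of `…EngineTwoLegStepV17FDoor{,Pkg,Legs}` (p526027/p526589/p527732).  The gen-7-flow two-leg slot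
has the SHAPE `TwoLegReadJetsF … n ∧ TwoLegSlopes … (klFlowFrameU … n) n ∧ TwoLegVolumeRateF L M hist Q β U μ n` where only the comparison HISTORY `hist`
changes between bundle revisions (`histV17F ∧ slopes` in rev 1, `histV17F2 ∧ slopes` in rev 2 — the cure-1 successor module re-keys the engine slot inside
the history and nothing else in the two-leg text).  This file states the (e)/(M) doors and the all-scales nested legs ONCE for an arbitrary
`hist : (L′ M′ : ℕ) → [NeZero L′] → [NeZero M′] → ℕ → Prop`:

* §1 `twoLegSlot_of_jets_slopes_nestedLegs` — the three-conjunct slot from (A) `TwoLegReadJetsF`, (B) `TwoLegSlopes … K_n n`, (C) two nested legs (quarter budget);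
  `twoLegSlot_of_jets_sepTubeGradient_nestedLegs[_pkg]` — the same with (A) from the angular jets at tables `cN ≤ G.S`, `cN' ≤ Q.S'` and (B) from p1b's shell
  data at the flow frame (curve-threshold / engine-threshold currencies); `twoLegSlot_zero_…` — the (M) form with `K₀ = 0` literal;
* §2 `cutLeg_allScales_of_step_hist` / `spLeg_allScales_of_step_hist` (+ `_quarter`) — the nested legs at all scales `≤ N` from a ONE-STEP comparison at
  comparable frames (strong induction; the frame comparability `|K_n^{(1)}(q) − K_n^{(2)}(q)| ≤ (Σ_{m<n} a m)/L₁` is DERIVED from the leg's own lower-scale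
  rates by k3c5-p3's `abs_eval_klFlowFrameU_sub_le_sum` + `abs_eval_klFlowPieceJackson_sub_le`), given only that `hist L M j` yields the `C⁴` reading at `j`
  (`hC`; for `histV17F∗ ∧ slopes`: `fun … h => h.1.2.2.2.1`).

The named instances for `TwoLegStepV17F2` are in `…EngineTwoLegStepV17F2Doors`.  Proofs only; no definitions; nothing about the model is asserted; nothing
asserts superconductivity.  [cite: BenfattoGiulianiMastropietro2006] (§2.4 (2.23)); KL STATUS 2026-08-27 l.2548 (ruling F), (R32) (S1 rev 2).
-/

noncomputable section

namespace Summit.HubbardSuperconductivity.HubbardSuperconductivity.Theorems.EngineV8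

set_option linter.dupNamespace false -- summit = problem name (single-conjunct summit), D-0017

open Real Finset Literature.MathematicalPhysics.QuantumLattice Literature.Probability.LatticeModels
open Literature.MathematicalPhysics.QuantumLattice.FermiRG Literature.MathematicalPhysics.QuantumLattice.BandSectorCounting
open Summit.HubbardSuperconductivity.HubbardSuperconductivity.Theorems.KLProgrammeLegKernels
open Summit.HubbardSuperconductivity.HubbardSuperconductivity.Theorems.DispersionFlow
open Summit.HubbardSuperconductivity.HubbardSuperconductivity.Theorems.PerturbedFermiCurve
open Summit.HubbardSuperconductivity.HubbardSuperconductivity.Theorems.KLRegimeSplit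
open Summit.HubbardSuperconductivity.HubbardSuperconductivity.Theorems.TwoPointAssembly

/-! ## §1 The slot of an arbitrary comparison history -/

section Slot

variable {L M : ℕ} [NeZero L] [NeZero M] {hist : (L' M' : ℕ) → [NeZero L'] → [NeZero M'] → ℕ → Prop}
  {G : GeoConsts} {Q : EngConsts} {R : RenConsts} {β U μ : ℝ} {n : ℕ}

/-- **The gen-7-flow two-leg slot for the comparison history `hist`** from (A) reading jets, (B) slopes at `K_n`, (C) two nested legs (quarter budget). -/
theorem twoLegSlot_of_jets_slopes_nestedLegs (h1 : TwoLegReadJetsF L M G Q β U μ n)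
    (h2 : TwoLegSlopes L M R β U μ (klFlowFrameU L M β U μ n) n) (hCL : 0 ≤ Q.CL β n)
    (hcut : ∀ (Mq : ℕ → ℕ) (L₁ M₁ M₂ : ℕ) [NeZero L₁] [NeZero M₁] [NeZero M₂], L ≤ L₁ → Q.M0 β L₁ ≤ M₁ → Mq L₁ ≤ M₁ → M₁ ≤ M₂ →
      (∀ j < n, hist L₁ M₁ j) → (∀ j < n, hist L₁ M₂ j) →
        ∀ θ : ℝ, |klLocalPart L₁ M₁ β U μ (klFlowFrameU L₁ M₁ β U μ n) n θ -
          klLocalPart L₁ M₂ β U μ (klFlowFrameU L₁ M₂ β U μ n) n θ| ≤ Q.CL β n / 4 / L₁)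
    (hsp : ∀ (Mq : ℕ → ℕ) (L₁ L₂ M₂ : ℕ) [NeZero L₁] [NeZero L₂] [NeZero M₂], L ≤ L₁ → L₁ ∣ L₂ → Q.M0 β L₁ ≤ M₂ → Mq L₁ ≤ M₂ →
      Q.M0 β L₂ ≤ M₂ → Mq L₂ ≤ M₂ → (∀ j < n, hist L₁ M₂ j) → (∀ j < n, hist L₂ M₂ j) →
        ∀ θ : ℝ, |klLocalPart L₁ M₂ β U μ (klFlowFrameU L₁ M₂ β U μ n) n θ -
          klLocalPart L₂ M₂ β U μ (klFlowFrameU L₂ M₂ β U μ n) n θ| ≤ Q.CL β n / 4 / L₁) :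
    TwoLegReadJetsF L M G Q β U μ n ∧ TwoLegSlopes L M R β U μ (klFlowFrameU L M β U μ n) n ∧ TwoLegVolumeRateF L M hist Q β U μ n :=
  ⟨h1, h2, twoLegVolumeRateF_of_nestedLegs_quarter hCL hcut hsp⟩

/-- **The slot for `hist`, curve-threshold currency**: (A) from the `C⁴` clause + angular jets at tables `cN ≤ G.S`, `cN' ≤ Q.S'`; (B) from the shell field
strength + shell-tube gradient + fit at `K_n` (`c ≤ klCurveC3 R`, `U ≤ klCurveU0 R`, `klEngL₃ β U ≤ L`, `n ≤ nScales β + 1`, `FrameOK … K_n`); (C) two nested legs. -/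
theorem twoLegSlot_of_jets_sepTubeGradient_nestedLegs (G : GeoConsts) (Q : EngConsts) {R : RenConsts}
    (hR : ∀ j, 0 ≤ R.Gfr j) {c : ℝ} (hc : 0 < c) (hcle : c ≤ klCurveC3 R) {μ : ℝ} (hμ : μ ∈ klWindowC) {U : ℝ} (hU : 0 < U)
    (hUle : U ≤ klCurveU0 R) {β : ℝ} (hβ : klBetaMin ≤ β) (hβc : β ≤ Real.exp (c / U ^ 2))
    (hL : klEngL₃ β U ≤ L) (hn : n ≤ nScales β + 1) (hK : FrameOK R U (nScales β) μ (klFlowFrameU L M β U μ n)) (hCL : 0 ≤ Q.CL β n)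
    {cN cN' : ℕ → ℝ} (hpk : ∀ k, cN k ≤ G.S k) (hpk' : ∀ k, cN' k ≤ Q.S' k)
    (hC : ContDiff ℝ 4 (fun θ : ℝ => klLocalPart L M β U μ (klFlowFrameU L M β U μ n) n θ))
    (hjets : ∀ k ≤ 4, ∀ θ : ℝ,
      |iteratedDeriv k (fun θ : ℝ => klLocalPart L M β U μ (klFlowFrameU L M β U μ n) n θ) θ| ≤ curveJetBar cN cN' U k n)
    (hz : ∀ k ∈ klShell L μ (klFlowFrameU L M β U μ n) n, |klFieldStrength L M β U μ (klFlowFrameU L M β U μ n) n k - 1| ≤ R.cz * |U|)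
    {m₁' : ℝ}
    (hm₁' : ∀ q : Momentum, |frameLevel μ (klFlowFrameU L M β U μ n) q| ≤ klScale klE0 n →
      ‖fderiv ℝ (evalM (symInterp L (fun p => klLocSelfEnergyRe L M β U μ (klFlowFrameU L M β U μ n) n p -
        (klFlowFrameU L M β U μ n).eval (latticeMomentum L p)))) q‖ ≤ m₁')
    (hfit1 : m₁' + 4 / 3 * R.Gfr 1 * U ^ 2 ≤ R.cz * |U| * (cDtmin (-1.2) (-0.05) / 2))
    (hcut : ∀ (Mq : ℕ → ℕ) (L₁ M₁ M₂ : ℕ) [NeZero L₁] [NeZero M₁] [NeZero M₂], L ≤ L₁ → Q.M0 β L₁ ≤ M₁ → Mq L₁ ≤ M₁ → M₁ ≤ M₂ →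
      (∀ j < n, hist L₁ M₁ j) → (∀ j < n, hist L₁ M₂ j) →
        ∀ θ : ℝ, |klLocalPart L₁ M₁ β U μ (klFlowFrameU L₁ M₁ β U μ n) n θ -
          klLocalPart L₁ M₂ β U μ (klFlowFrameU L₁ M₂ β U μ n) n θ| ≤ Q.CL β n / 4 / L₁)
    (hsp : ∀ (Mq : ℕ → ℕ) (L₁ L₂ M₂ : ℕ) [NeZero L₁] [NeZero L₂] [NeZero M₂], L ≤ L₁ → L₁ ∣ L₂ → Q.M0 β L₁ ≤ M₂ → Mq L₁ ≤ M₂ →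
      Q.M0 β L₂ ≤ M₂ → Mq L₂ ≤ M₂ → (∀ j < n, hist L₁ M₂ j) → (∀ j < n, hist L₂ M₂ j) →
        ∀ θ : ℝ, |klLocalPart L₁ M₂ β U μ (klFlowFrameU L₁ M₂ β U μ n) n θ -
          klLocalPart L₂ M₂ β U μ (klFlowFrameU L₂ M₂ β U μ n) n θ| ≤ Q.CL β n / 4 / L₁) :
    TwoLegReadJetsF L M G Q β U μ n ∧ TwoLegSlopes L M R β U μ (klFlowFrameU L M β U μ n) n ∧ TwoLegVolumeRateF L M hist Q β U μ n :=
  twoLegSlot_of_jets_slopes_nestedLegs (twoLegReadJetsF_of_jets G Q hpk hpk' hC hjets)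
    (twoLegSlopes_flowFrame_of_sepTubeGradient hR hc hcle hU hUle hβ hβc hμ hn hK hL hz hm₁' hfit1) hCL hcut hsp

/-- **The slot for `hist`, engine-threshold currency** (`R.WF2`, `c ≤ klEngC₃3 P R`, `U ≤ klEngU₀4 P R c`; a raised threshold composes by `le_trans`). -/
theorem twoLegSlot_of_jets_sepTubeGradient_nestedLegs_pkg (G : GeoConsts) (Q : EngConsts) (P : SplitConsts) {R : RenConsts} (hR : R.WF2)
    {c : ℝ} (hc : 0 < c) (hc3 : c ≤ klEngC₃3 P R) {μ : ℝ} (hμ : μ ∈ klWindowC) {U : ℝ} (hU : 0 < U) (hUle : U ≤ klEngU₀4 P R c)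
    {β : ℝ} (hβ : klBetaMin ≤ β) (hβc : β ≤ Real.exp (c / U ^ 2)) (hL : klEngL₃ β U ≤ L) (hn : n ≤ nScales β + 1)
    (hK : FrameOK R U (nScales β) μ (klFlowFrameU L M β U μ n)) (hCL : 0 ≤ Q.CL β n)
    {cN cN' : ℕ → ℝ} (hpk : ∀ k, cN k ≤ G.S k) (hpk' : ∀ k, cN' k ≤ Q.S' k)
    (hC : ContDiff ℝ 4 (fun θ : ℝ => klLocalPart L M β U μ (klFlowFrameU L M β U μ n) n θ))
    (hjets : ∀ k ≤ 4, ∀ θ : ℝ,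
      |iteratedDeriv k (fun θ : ℝ => klLocalPart L M β U μ (klFlowFrameU L M β U μ n) n θ) θ| ≤ curveJetBar cN cN' U k n)
    (hz : ∀ k ∈ klShell L μ (klFlowFrameU L M β U μ n) n, |klFieldStrength L M β U μ (klFlowFrameU L M β U μ n) n k - 1| ≤ R.cz * |U|)
    {m₁' : ℝ}
    (hm₁' : ∀ q : Momentum, |frameLevel μ (klFlowFrameU L M β U μ n) q| ≤ klScale klE0 n →
      ‖fderiv ℝ (evalM (symInterp L (fun p => klLocSelfEnergyRe L M β U μ (klFlowFrameU L M β U μ n) n p -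
        (klFlowFrameU L M β U μ n).eval (latticeMomentum L p)))) q‖ ≤ m₁')
    (hfit1 : m₁' + 4 / 3 * R.Gfr 1 * U ^ 2 ≤ R.cz * |U| * (cDtmin (-1.2) (-0.05) / 2))
    (hcut : ∀ (Mq : ℕ → ℕ) (L₁ M₁ M₂ : ℕ) [NeZero L₁] [NeZero M₁] [NeZero M₂], L ≤ L₁ → Q.M0 β L₁ ≤ M₁ → Mq L₁ ≤ M₁ → M₁ ≤ M₂ →
      (∀ j < n, hist L₁ M₁ j) → (∀ j < n, hist L₁ M₂ j) →
        ∀ θ : ℝ, |klLocalPart L₁ M₁ β U μ (klFlowFrameU L₁ M₁ β U μ n) n θ -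
          klLocalPart L₁ M₂ β U μ (klFlowFrameU L₁ M₂ β U μ n) n θ| ≤ Q.CL β n / 4 / L₁)
    (hsp : ∀ (Mq : ℕ → ℕ) (L₁ L₂ M₂ : ℕ) [NeZero L₁] [NeZero L₂] [NeZero M₂], L ≤ L₁ → L₁ ∣ L₂ → Q.M0 β L₁ ≤ M₂ → Mq L₁ ≤ M₂ →
      Q.M0 β L₂ ≤ M₂ → Mq L₂ ≤ M₂ → (∀ j < n, hist L₁ M₂ j) → (∀ j < n, hist L₂ M₂ j) →
        ∀ θ : ℝ, |klLocalPart L₁ M₂ β U μ (klFlowFrameU L₁ M₂ β U μ n) n θ -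
          klLocalPart L₂ M₂ β U μ (klFlowFrameU L₂ M₂ β U μ n) n θ| ≤ Q.CL β n / 4 / L₁) :
    TwoLegReadJetsF L M G Q β U μ n ∧ TwoLegSlopes L M R β U μ (klFlowFrameU L M β U μ n) n ∧ TwoLegVolumeRateF L M hist Q β U μ n :=
  have hR' : ∀ j, 0 ≤ R.Gfr j := hR.1.2.2
  twoLegSlot_of_jets_sepTubeGradient_nestedLegs G Q hR' hc (hc3.trans (klEngC₃3_le_klCurveC3 P hR')) hμ hU
    ((le_klEngU₀3_of_le_klEngU₀4 hUle).trans (klEngU₀3_le_klCurveU0 P hR' c)) hβ hβc hL hn hK hCL hpk hpk' hC hjets hz hm₁' hfit1 hcut hsp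

end Slot

/-! ## §2 The nested legs at all scales from a one-step comparison, for an arbitrary comparison history yielding `C⁴` readings -/

section Legs

variable {L : ℕ} {hist : (L' M' : ℕ) → [NeZero L'] → [NeZero M'] → ℕ → Prop} {Q : EngConsts} {β U μ : ℝ}

/-- **Frame comparability at scale `n` from the rates below `n`**, the readings' `C⁴`-ness read off `hist` through `hC`. -/
theorem abs_eval_klFlowFrameU_sub_le_of_rates_hist {L₁ M₁ L₂ M₂ : ℕ} [NeZero L₁] [NeZero M₁] [NeZero L₂] [NeZero M₂] (hμ : μ ∈ klWindowC)
    (hC : ∀ (L' M' : ℕ) [NeZero L'] [NeZero M'] (j : ℕ), hist L' M' j →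
      ContDiff ℝ 4 (fun θ : ℝ => klLocalPart L' M' β U μ (klFlowFrameU L' M' β U μ j) j θ))
    {n : ℕ} {a : ℕ → ℝ} (h₁ : ∀ j < n, hist L₁ M₁ j) (h₂ : ∀ j < n, hist L₂ M₂ j)
    (hrates : ∀ m < n, ∀ θ : ℝ, |klLocalPart L₁ M₁ β U μ (klFlowFrameU L₁ M₁ β U μ m) m θ -
      klLocalPart L₂ M₂ β U μ (klFlowFrameU L₂ M₂ β U μ m) m θ| ≤ a m / L₁) (q : Fin 2 → ℝ) :
    |(klFlowFrameU L₁ M₁ β U μ n).eval q - (klFlowFrameU L₂ M₂ β U μ n).eval q| ≤ (∑ m ∈ range n, a m) / L₁ := by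
  rw [Finset.sum_div]
  exact abs_eval_klFlowFrameU_sub_le_sum β U μ n q fun m hm =>
    abs_eval_klFlowPieceJackson_sub_le hμ m (hC L₁ M₁ m (h₁ m hm)) (hC L₂ M₂ m (h₂ m hm)) (hrates m hm) q

/-- **CUTOFF LEG AT ALL SCALES `≤ N` FROM THE ONE-STEP COMPARISON, arbitrary history** (as `cutLeg_allScales_of_step`, `hist` in place of `histV17F ∧ slopes`). -/
theorem cutLeg_allScales_of_step_hist (hμ : μ ∈ klWindowC)
    (hC : ∀ (L' M' : ℕ) [NeZero L'] [NeZero M'] (j : ℕ), hist L' M' j →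
      ContDiff ℝ 4 (fun θ : ℝ => klLocalPart L' M' β U μ (klFlowFrameU L' M' β U μ j) j θ))
    {N : ℕ} {a : ℕ → ℝ}
    (hstep : ∀ n ≤ N, ∀ (Mq : ℕ → ℕ) (L₁ M₁ M₂ : ℕ) [NeZero L₁] [NeZero M₁] [NeZero M₂], L ≤ L₁ → Q.M0 β L₁ ≤ M₁ → Mq L₁ ≤ M₁ → M₁ ≤ M₂ →
      (∀ j < n, hist L₁ M₁ j) → (∀ j < n, hist L₁ M₂ j) →
      (∀ m < n, ∀ θ : ℝ, |klLocalPart L₁ M₁ β U μ (klFlowFrameU L₁ M₁ β U μ m) m θ -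
        klLocalPart L₁ M₂ β U μ (klFlowFrameU L₁ M₂ β U μ m) m θ| ≤ a m / L₁) →
      (∀ q : Fin 2 → ℝ, |(klFlowFrameU L₁ M₁ β U μ n).eval q - (klFlowFrameU L₁ M₂ β U μ n).eval q| ≤ (∑ m ∈ range n, a m) / L₁) →
        ∀ θ : ℝ, |klLocalPart L₁ M₁ β U μ (klFlowFrameU L₁ M₁ β U μ n) n θ -
          klLocalPart L₁ M₂ β U μ (klFlowFrameU L₁ M₂ β U μ n) n θ| ≤ a n / L₁) :
    ∀ n ≤ N, ∀ (Mq : ℕ → ℕ) (L₁ M₁ M₂ : ℕ) [NeZero L₁] [NeZero M₁] [NeZero M₂], L ≤ L₁ → Q.M0 β L₁ ≤ M₁ → Mq L₁ ≤ M₁ → M₁ ≤ M₂ →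
      (∀ j < n, hist L₁ M₁ j) → (∀ j < n, hist L₁ M₂ j) →
        ∀ θ : ℝ, |klLocalPart L₁ M₁ β U μ (klFlowFrameU L₁ M₁ β U μ n) n θ -
          klLocalPart L₁ M₂ β U μ (klFlowFrameU L₁ M₂ β U μ n) n θ| ≤ a n / L₁ := by
  intro n
  induction n using Nat.strong_induction_on with
  | _ n ih =>
    intro hn Mq L₁ M₁ M₂ _ _ _ hL hM hMq hM₁₂ hh₁ hh₂
    have hrates : ∀ m < n, ∀ θ : ℝ, |klLocalPart L₁ M₁ β U μ (klFlowFrameU L₁ M₁ β U μ m) m θ -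
        klLocalPart L₁ M₂ β U μ (klFlowFrameU L₁ M₂ β U μ m) m θ| ≤ a m / L₁ := fun m hm =>
      ih m hm (by omega) Mq L₁ M₁ M₂ hL hM hMq hM₁₂ (fun j hj => hh₁ j (hj.trans hm)) (fun j hj => hh₂ j (hj.trans hm))
    exact hstep n hn Mq L₁ M₁ M₂ hL hM hMq hM₁₂ hh₁ hh₂ hrates
      (abs_eval_klFlowFrameU_sub_le_of_rates_hist (L₁ := L₁) (M₁ := M₁) (L₂ := L₁) (M₂ := M₂) hμ hC hh₁ hh₂ hrates)

/-- **SPATIAL NESTED LEG AT ALL SCALES `≤ N` FROM THE ONE-STEP COMPARISON, arbitrary history.** -/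
theorem spLeg_allScales_of_step_hist (hμ : μ ∈ klWindowC)
    (hC : ∀ (L' M' : ℕ) [NeZero L'] [NeZero M'] (j : ℕ), hist L' M' j →
      ContDiff ℝ 4 (fun θ : ℝ => klLocalPart L' M' β U μ (klFlowFrameU L' M' β U μ j) j θ))
    {N : ℕ} {a : ℕ → ℝ}
    (hstep : ∀ n ≤ N, ∀ (Mq : ℕ → ℕ) (L₁ L₂ M₂ : ℕ) [NeZero L₁] [NeZero L₂] [NeZero M₂], L ≤ L₁ → L₁ ∣ L₂ → Q.M0 β L₁ ≤ M₂ → Mq L₁ ≤ M₂ →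
      Q.M0 β L₂ ≤ M₂ → Mq L₂ ≤ M₂ → (∀ j < n, hist L₁ M₂ j) → (∀ j < n, hist L₂ M₂ j) →
      (∀ m < n, ∀ θ : ℝ, |klLocalPart L₁ M₂ β U μ (klFlowFrameU L₁ M₂ β U μ m) m θ -
        klLocalPart L₂ M₂ β U μ (klFlowFrameU L₂ M₂ β U μ m) m θ| ≤ a m / L₁) →
      (∀ q : Fin 2 → ℝ, |(klFlowFrameU L₁ M₂ β U μ n).eval q - (klFlowFrameU L₂ M₂ β U μ n).eval q| ≤ (∑ m ∈ range n, a m) / L₁) →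
        ∀ θ : ℝ, |klLocalPart L₁ M₂ β U μ (klFlowFrameU L₁ M₂ β U μ n) n θ -
          klLocalPart L₂ M₂ β U μ (klFlowFrameU L₂ M₂ β U μ n) n θ| ≤ a n / L₁) :
    ∀ n ≤ N, ∀ (Mq : ℕ → ℕ) (L₁ L₂ M₂ : ℕ) [NeZero L₁] [NeZero L₂] [NeZero M₂], L ≤ L₁ → L₁ ∣ L₂ → Q.M0 β L₁ ≤ M₂ → Mq L₁ ≤ M₂ →
      Q.M0 β L₂ ≤ M₂ → Mq L₂ ≤ M₂ → (∀ j < n, hist L₁ M₂ j) → (∀ j < n, hist L₂ M₂ j) →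
        ∀ θ : ℝ, |klLocalPart L₁ M₂ β U μ (klFlowFrameU L₁ M₂ β U μ n) n θ -
          klLocalPart L₂ M₂ β U μ (klFlowFrameU L₂ M₂ β U μ n) n θ| ≤ a n / L₁ := by
  intro n
  induction n using Nat.strong_induction_on with
  | _ n ih =>
    intro hn Mq L₁ L₂ M₂ _ _ _ hL hdvd hM₁ hMq₁ hM₂ hMq₂ hh₁ hh₂
    have hrates : ∀ m < n, ∀ θ : ℝ, |klLocalPart L₁ M₂ β U μ (klFlowFrameU L₁ M₂ β U μ m) m θ -
        klLocalPart L₂ M₂ β U μ (klFlowFrameU L₂ M₂ β U μ m) m θ| ≤ a m / L₁ := fun m hm =>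
      ih m hm (by omega) Mq L₁ L₂ M₂ hL hdvd hM₁ hMq₁ hM₂ hMq₂ (fun j hj => hh₁ j (hj.trans hm)) (fun j hj => hh₂ j (hj.trans hm))
    exact hstep n hn Mq L₁ L₂ M₂ hL hdvd hM₁ hMq₁ hM₂ hMq₂ hh₁ hh₂ hrates
      (abs_eval_klFlowFrameU_sub_le_of_rates_hist (L₁ := L₁) (M₁ := M₂) (L₂ := L₂) (M₂ := M₂) hμ hC hh₁ hh₂ hrates)

end Legs

end Summit.HubbardSuperconductivity.HubbardSuperconductivity.Theorems.EngineV8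

end
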